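import Mathlib

/-!
# Route `FilamentSkeletonRss` · `SkeletonJ1L` (stmt-NavierStokesRegularity-23296) · alt line `fuchsian_newton_L` stub (R♭) `BoxFrequencyInverseL`
# — the POINTWISE WEIGHTED ENERGY INEQUALITY of the frozen stagnation box on the frequency side

The frozen stagnation box solved on the frequency side (Cruxes/SkeletonJ1L/Lines/fuchsian_newton_L.lean §3b, stub `stub_boxFrequencyL :
BoxFrequencyInverseL`, «M, provable now») is the linear ODE `w′(Z + kZ′) + m(k)·i·Z + S Z = f` on `k > 0`, typed as
`HasDerivAt Z ((w′k)⁻¹ • (f k − (w′•Z k + (m k·i)·Z k + S (Z k)))) k`, with `S` real-linear, `Re(z̄·Sz) ≤ lam‖z‖²`, and the claim is the weighted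
`L²` bound `∫ e^{2hk}k^{2θ}‖Z‖² ≤ (w′(θ−½) − lam)⁻² ∫ e^{2hk}k^{2θ}‖f‖²` for the solution vanishing beyond `kf`.  Its engine is the backward energy
inequality for `E(k) = e^{2hk}k^{2θ}‖Z(k)‖²` — the skew term `m·i` DROPS OUT — which this file proves pointwise:
* `inner_deriv_ge` — along the ODE, `⟪Z, Z′⟫_ℝ ≥ −(w′k)⁻¹(‖Z‖‖f‖ + (w′ + lam)‖Z‖²)` (the `m·i·Z` term contributes `Re(i·m‖Z‖²) = 0`);
* `weightedEnergy_hasDerivAt` — `E′ = e^{2hk}(2h·k^{2θ}‖Z‖² + 2θ·k^{2θ−1}‖Z‖² + k^{2θ}·2⟪Z, Z′⟫)`;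
* `weightedEnergy_deriv_ge` — hence `E′ ≥ e^{2hk}k^{2θ−1}((2hk + 2θ − 2 − 2lam/w′)‖Z‖² − (2/w′)‖Z‖‖f‖)`.
* (appended) `kEnergy_deriv_ge` + `boxFrequency_apriori` — THE A-PRIORI WEIGHTED `L²` BOUND with the stub's constant: every solution on `(0, kf]`
  with `Z(kf) = 0` and integrable weighted energies satisfies `∫_{(0,kf]} e^{2hk}k^{2θ}‖Z‖² ≤ (w′(θ−½) − lam)⁻² ∫_{(0,kf]} e^{2hk}k^{2θ}‖f‖²`
  (`G = k·E`, `G′ ≥ A·E − (Aw′²)⁻¹e^{2hk}k^{2θ}‖f‖²` with `A = θ−½−lam/w′`, FTC inequality on `[ε, kf]`, `ε ↓ 0` by monotone convergence; no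
  continuity of `f`, `m` needed).
What remains for (R♭) (census): ONLY the existence of the solution on `(0, kf]` with `Z(kf) = 0` (linear ODE, coefficients continuous on `(0,∞)`,
solved backward from `kf`, extended by `0` beyond) and its weighted integrability near `k = 0`.  `--supports stmt-NavierStokesRegularity-23296`.
HONEST FRAMING: elementary calculus for a plan about a HYPOTHETICAL filament skeleton on the NEGATIVE side of a MODEL route; no stub is closed;
nothing here bears on Navier–Stokes regularity or blow-up.
-/

set_option linter.dupNamespace false

noncomputable section

namespace Summit.NavierStokesRegularity.NavierStokesRegularity.Theorems.BoxFrequencyEnergy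

open Real
open scoped InnerProductSpace ComplexConjugate

/-- The real pairing of `Z` with the skew term `(m·i)·Z` vanishes: `⟪Z, (m i) Z⟫_ℝ = 0`. [folklore] -/
theorem real_inner_skew_self (m : ℝ) (z : ℂ) : ⟪z, ((m : ℂ) * Complex.I) * z⟫_ℝ = 0 := by
  rw [Complex.inner]
  have h : (m : ℂ) * Complex.I * z * conj z = (m : ℂ) * Complex.I * ((Complex.normSq z : ℝ) : ℂ) := by
    rw [← Complex.mul_conj]; ring
  rw [h]
  simp [Complex.mul_re, Complex.mul_im]

/-- The real pairing of `Z` with `S Z` is the stub's `Re(z̄·Sz)`. [folklore] -/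
theorem real_inner_apply_eq (S : ℂ →L[ℝ] ℂ) (z : ℂ) : ⟪z, S z⟫_ℝ = (starRingEnd ℂ z * S z).re := by
  rw [Complex.inner, mul_comm]

/-- **The skew term drops out:** along the frozen-box ODE `Z′ = (w′k)⁻¹ • (f − (w′•Z + (m i)·Z + S Z))` with `Re(z̄·Sz) ≤ lam‖z‖²`,
`⟪Z, Z′⟫_ℝ ≥ −(w′k)⁻¹·(‖Z‖‖f‖ + (w′ + lam)‖Z‖²)`. [folklore] -/
theorem inner_deriv_ge {w' lam k mk : ℝ} {S : ℂ →L[ℝ] ℂ} {fk Zk Z'k : ℂ} (hw : 0 < w') (hk : 0 < k)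
    (hS : ∀ z : ℂ, (starRingEnd ℂ z * S z).re ≤ lam * ‖z‖ ^ 2)
    (hZ' : Z'k = (w' * k)⁻¹ • (fk - (w' • Zk + ((mk : ℂ) * Complex.I) * Zk + S Zk))) :
    -((w' * k)⁻¹ * (‖Zk‖ * ‖fk‖ + (w' + lam) * ‖Zk‖ ^ 2)) ≤ ⟪Zk, Z'k⟫_ℝ := by
  have hexp : ⟪Zk, Z'k⟫_ℝ = (w' * k)⁻¹ * (⟪Zk, fk⟫_ℝ - w' * ‖Zk‖ ^ 2 - (starRingEnd ℂ Zk * S Zk).re) := by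
    rw [hZ', real_inner_smul_right, inner_sub_right, inner_add_right, inner_add_right, real_inner_smul_right,
      real_inner_self_eq_norm_sq, real_inner_skew_self, real_inner_apply_eq]
    ring
  rw [hexp]
  have ha : 0 ≤ (w' * k)⁻¹ := inv_nonneg.2 (mul_pos hw hk).le
  have h1 : -(‖Zk‖ * ‖fk‖) ≤ ⟪Zk, fk⟫_ℝ := by
    have := abs_real_inner_le_norm Zk fk
    linarith [neg_abs_le ⟪Zk, fk⟫_ℝ]
  have h2 := hS Zk
  rw [neg_mul_eq_mul_neg]
  exact mul_le_mul_of_nonneg_left (by linarith) ha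

/-- Derivative of the weighted energy `E(s) = e^{2hs}·s^{2θ}·‖Z s‖²` at `k > 0`. [folklore] -/
theorem weightedEnergy_hasDerivAt {Z : ℝ → ℂ} {Z'k : ℂ} {h θ k : ℝ} (hk : 0 < k) (hZ : HasDerivAt Z Z'k k) :
    HasDerivAt (fun s => Real.exp (2 * h * s) * s ^ (2 * θ) * ‖Z s‖ ^ 2)
      (Real.exp (2 * h * k) * (2 * h * k ^ (2 * θ) * ‖Z k‖ ^ 2 + 2 * θ * k ^ (2 * θ - 1) * ‖Z k‖ ^ 2
        + k ^ (2 * θ) * (2 * ⟪Z k, Z'k⟫_ℝ))) k := by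
  have he : HasDerivAt (fun s => Real.exp (2 * h * s)) (Real.exp (2 * h * k) * (2 * h)) k := by
    have h1 : HasDerivAt (fun s => 2 * h * s) (2 * h * 1) k := (hasDerivAt_id' k).const_mul (2 * h)
    simpa using h1.exp
  have hp : HasDerivAt (fun s : ℝ => s ^ (2 * θ)) (1 * (2 * θ) * k ^ (2 * θ - 1)) k :=
    (hasDerivAt_id' k).rpow_const (Or.inl hk.ne')
  have hn : HasDerivAt (fun s => ‖Z s‖ ^ 2) (2 * ⟪Z k, Z'k⟫_ℝ) k := hZ.norm_sq
  exact ((he.mul hp).mul hn).congr_deriv (by simp only [Pi.mul_apply]; ring)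

/-- **Backward energy inequality, pointwise:** along the frozen-box ODE at `k > 0`,
`E′(k) ≥ e^{2hk}·k^{2θ−1}·((2hk + 2θ − 2 − 2lam/w′)‖Z‖² − (2/w′)‖Z‖‖f‖)`, `E(s) = e^{2hs}s^{2θ}‖Z s‖²`. [folklore] -/
theorem weightedEnergy_deriv_ge {w' lam h θ k : ℝ} {S : ℂ →L[ℝ] ℂ} {m : ℝ → ℝ} {f Z : ℝ → ℂ} (hw : 0 < w') (hk : 0 < k)
    (hS : ∀ z : ℂ, (starRingEnd ℂ z * S z).re ≤ lam * ‖z‖ ^ 2)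
    (hZ : HasDerivAt Z ((w' * k)⁻¹ • (f k - (w' • Z k + ((m k : ℂ) * Complex.I) * Z k + S (Z k)))) k) :
    Real.exp (2 * h * k) * k ^ (2 * θ - 1) *
        ((2 * h * k + 2 * θ - 2 - 2 * lam / w') * ‖Z k‖ ^ 2 - 2 / w' * (‖Z k‖ * ‖f k‖)) ≤
      deriv (fun s => Real.exp (2 * h * s) * s ^ (2 * θ) * ‖Z s‖ ^ 2) k := by
  rw [(weightedEnergy_hasDerivAt hk hZ).deriv]
  have hinner := inner_deriv_ge (mk := m k) (fk := f k) (Zk := Z k) hw hk hS rfl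
  have hP : k ^ (2 * θ) = k * k ^ (2 * θ - 1) := by
    rw [Real.rpow_sub_one hk.ne', mul_div_cancel₀ _ hk.ne']
  have hE : 0 < Real.exp (2 * h * k) := Real.exp_pos _
  have hQ : 0 < k ^ (2 * θ - 1) := Real.rpow_pos_of_pos hk _
  -- the difference is `2·e^{2hk}·k^{2θ}·(⟪Z, Z′⟫ − lower bound) ≥ 0`
  have hkey : Real.exp (2 * h * k) * (2 * h * k ^ (2 * θ) * ‖Z k‖ ^ 2 + 2 * θ * k ^ (2 * θ - 1) * ‖Z k‖ ^ 2
        + k ^ (2 * θ) * (2 * ⟪Z k, (w' * k)⁻¹ • (f k - (w' • Z k + ((m k : ℂ) * Complex.I) * Z k + S (Z k)))⟫_ℝ))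
      - Real.exp (2 * h * k) * k ^ (2 * θ - 1) *
        ((2 * h * k + 2 * θ - 2 - 2 * lam / w') * ‖Z k‖ ^ 2 - 2 / w' * (‖Z k‖ * ‖f k‖))
      = 2 * (Real.exp (2 * h * k) * (k * k ^ (2 * θ - 1))) *
        (⟪Z k, (w' * k)⁻¹ • (f k - (w' • Z k + ((m k : ℂ) * Complex.I) * Z k + S (Z k)))⟫_ℝ
          - -((w' * k)⁻¹ * (‖Z k‖ * ‖f k‖ + (w' + lam) * ‖Z k‖ ^ 2))) := by
    rw [hP]
    field_simp
    ring
  have hnn : 0 ≤ 2 * (Real.exp (2 * h * k) * (k * k ^ (2 * θ - 1))) *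
      (⟪Z k, (w' * k)⁻¹ • (f k - (w' • Z k + ((m k : ℂ) * Complex.I) * Z k + S (Z k)))⟫_ℝ
        - -((w' * k)⁻¹ * (‖Z k‖ * ‖f k‖ + (w' + lam) * ‖Z k‖ ^ 2))) :=
    mul_nonneg (by positivity) (sub_nonneg.2 hinner)
  linarith [hkey, hnn]

/-! ## The a-priori weighted `L²` bound (appended, same hand): the analytic half of (R♭)

For ANY solution of the frozen-box ODE on `(0, kf]` with `Z(kf) = 0` whose weighted energy is integrable, the stub's estimate holds with the stub's
constant: `∫_{(0,kf]} e^{2hk}k^{2θ}‖Z‖² ≤ (w′(θ−½) − lam)⁻² ∫_{(0,kf]} e^{2hk}k^{2θ}‖f‖²`.  Mechanism: with `G(k) = k·E(k)` the pointwise inequality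
`G′ ≥ A·E − (A w′²)⁻¹·e^{2hk}k^{2θ}‖f‖²`, `A = θ − ½ − lam/w′ > 0` (the skew term gone, AM–GM with the optimal weight), integrated on `[ε, kf]` by the
FTC inequality (`G(kf) − G(ε) = −εE(ε) ≤ 0`; no continuity of `f`, `m` needed), then `ε ↓ 0` by monotone convergence of set integrals.  What then
remains of (R♭) is only the EXISTENCE of such a solution (linear ODE with coefficients continuous on `(0,∞)`, solved backward from `kf`) and its
weighted integrability near `k = 0`. -/

/-- Pointwise engine for the a-priori bound: with `E(k) = e^{2hk}k^{2θ}‖Z k‖²`, `G(k) = k·E(k)` and `A = θ − ½ − lam/w′`, along the ODE at `k > 0`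
(`h ≥ 0`): `A·E(k) − (w′²A)⁻¹·e^{2hk}k^{2θ}‖f k‖² ≤ G′(k)` where `G′(k) = E(k) + k·E′(k)` is the explicit derivative. [folklore] -/
theorem kEnergy_deriv_ge {w' lam h θ k : ℝ} {S : ℂ →L[ℝ] ℂ} {mk : ℝ} {fk Zk Z'k : ℂ} (hw : 0 < w') (hk : 0 < k) (hh : 0 ≤ h)
    (hA : 0 < θ - 1 / 2 - lam / w')
    (hS : ∀ z : ℂ, (starRingEnd ℂ z * S z).re ≤ lam * ‖z‖ ^ 2)
    (hZ' : Z'k = (w' * k)⁻¹ • (fk - (w' • Zk + ((mk : ℂ) * Complex.I) * Zk + S Zk))) :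
    (θ - 1 / 2 - lam / w') * (Real.exp (2 * h * k) * k ^ (2 * θ) * ‖Zk‖ ^ 2)
        - (w' ^ 2 * (θ - 1 / 2 - lam / w'))⁻¹ * (Real.exp (2 * h * k) * k ^ (2 * θ) * ‖fk‖ ^ 2) ≤
      Real.exp (2 * h * k) * k ^ (2 * θ) * ‖Zk‖ ^ 2
        + k * (Real.exp (2 * h * k) * (2 * h * k ^ (2 * θ) * ‖Zk‖ ^ 2 + 2 * θ * k ^ (2 * θ - 1) * ‖Zk‖ ^ 2
          + k ^ (2 * θ) * (2 * ⟪Zk, Z'k⟫_ℝ))) := by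
  set A : ℝ := θ - 1 / 2 - lam / w' with hAdef
  set q : ℝ := k ^ (2 * θ) with hq
  set e : ℝ := Real.exp (2 * h * k) with he
  have hqpos : 0 < q := Real.rpow_pos_of_pos hk _
  have hepos : 0 < e := Real.exp_pos _
  have hqr : k * k ^ (2 * θ - 1) = q := by
    rw [hq, Real.rpow_sub_one hk.ne', mul_div_cancel₀ _ hk.ne']
  have hP := inner_deriv_ge (mk := mk) (fk := fk) (Zk := Zk) hw hk hS hZ'
  -- the pairing term in `q`-units: `k·q·2P ≥ −(2q/w′)(‖Z‖‖f‖ + (w′+lam)‖Z‖²)`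
  have h1 : -(2 * q / w' * (‖Zk‖ * ‖fk‖ + (w' + lam) * ‖Zk‖ ^ 2)) ≤ k * (q * (2 * ⟪Zk, Z'k⟫_ℝ)) := by
    have h2 := mul_le_mul_of_nonneg_left hP (show 0 ≤ 2 * k * q by positivity)
    have h3 : 2 * k * q * -((w' * k)⁻¹ * (‖Zk‖ * ‖fk‖ + (w' + lam) * ‖Zk‖ ^ 2)) =
        -(2 * q / w' * (‖Zk‖ * ‖fk‖ + (w' + lam) * ‖Zk‖ ^ 2)) := by
      field_simp
    rw [h3] at h2
    linarith
  -- AM–GM with the optimal weight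
  have h2 : 2 / w' * (‖Zk‖ * ‖fk‖) ≤ A * ‖Zk‖ ^ 2 + (w' ^ 2 * A)⁻¹ * ‖fk‖ ^ 2 := by
    have hAw : 0 < w' ^ 2 * A := by positivity
    have key : A * ‖Zk‖ ^ 2 + (w' ^ 2 * A)⁻¹ * ‖fk‖ ^ 2 - 2 / w' * (‖Zk‖ * ‖fk‖) =
        (A * w' * ‖Zk‖ - ‖fk‖) ^ 2 / (w' ^ 2 * A) := by
      field_simp
      ring
    have : 0 ≤ (A * w' * ‖Zk‖ - ‖fk‖) ^ 2 / (w' ^ 2 * A) := by positivity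
    linarith
  have h2q := mul_le_mul_of_nonneg_right h2 hqpos.le
  have h4 : 0 ≤ 2 * h * k * q * ‖Zk‖ ^ 2 := by positivity
  -- the bracket inequality (everything divided by `e`)
  have hbr : A * (q * ‖Zk‖ ^ 2) - (w' ^ 2 * A)⁻¹ * (q * ‖fk‖ ^ 2) ≤
      q * ‖Zk‖ ^ 2 + k * (2 * h * q * ‖Zk‖ ^ 2 + 2 * θ * k ^ (2 * θ - 1) * ‖Zk‖ ^ 2 + q * (2 * ⟪Zk, Z'k⟫_ℝ)) := by
    have hsplit : k * (2 * h * q * ‖Zk‖ ^ 2 + 2 * θ * k ^ (2 * θ - 1) * ‖Zk‖ ^ 2 + q * (2 * ⟪Zk, Z'k⟫_ℝ)) =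
        2 * h * k * q * ‖Zk‖ ^ 2 + 2 * θ * (k * k ^ (2 * θ - 1)) * ‖Zk‖ ^ 2 + k * (q * (2 * ⟪Zk, Z'k⟫_ℝ)) := by ring
    rw [hsplit, hqr]
    have hAdef' : A = θ - 1 / 2 - lam / w' := hAdef
    have hlam : 2 * q / w' * ((w' + lam) * ‖Zk‖ ^ 2) = 2 * q * ‖Zk‖ ^ 2 + 2 * (lam / w') * (q * ‖Zk‖ ^ 2) := by
      field_simp
    have h1' : -(2 / w' * (‖Zk‖ * ‖fk‖) * q) - (2 * q * ‖Zk‖ ^ 2 + 2 * (lam / w') * (q * ‖Zk‖ ^ 2)) ≤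
        k * (q * (2 * ⟪Zk, Z'k⟫_ℝ)) := by
      have : -(2 * q / w' * (‖Zk‖ * ‖fk‖ + (w' + lam) * ‖Zk‖ ^ 2)) =
          -(2 / w' * (‖Zk‖ * ‖fk‖) * q) - 2 * q / w' * ((w' + lam) * ‖Zk‖ ^ 2) := by ring
      rw [this, hlam] at h1
      exact h1
    rw [hAdef'] at h2q ⊢
    nlinarith [h1', h2q, h4]
  have hfin := mul_le_mul_of_nonneg_left hbr hepos.le
  have el : e * (A * (q * ‖Zk‖ ^ 2) - (w' ^ 2 * A)⁻¹ * (q * ‖fk‖ ^ 2)) =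
      A * (e * q * ‖Zk‖ ^ 2) - (w' ^ 2 * A)⁻¹ * (e * q * ‖fk‖ ^ 2) := by ring
  have er : e * (q * ‖Zk‖ ^ 2 + k * (2 * h * q * ‖Zk‖ ^ 2 + 2 * θ * k ^ (2 * θ - 1) * ‖Zk‖ ^ 2 + q * (2 * ⟪Zk, Z'k⟫_ℝ))) =
      e * q * ‖Zk‖ ^ 2 + k * (e * (2 * h * q * ‖Zk‖ ^ 2 + 2 * θ * k ^ (2 * θ - 1) * ‖Zk‖ ^ 2 + q * (2 * ⟪Zk, Z'k⟫_ℝ))) := by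
    ring
  rw [el, er] at hfin
  exact hfin

/-- **A-priori weighted `L²` bound of the frozen stagnation box** (the analytic half of stub (R♭) `BoxFrequencyInverseL`, with its constant):
every solution of the ODE on `(0, kf]` with `Z(kf) = 0` and integrable weighted energies satisfies
`∫_{(0,kf]} e^{2hk}k^{2θ}‖Z‖² ≤ (w′(θ−½) − lam)⁻² · ∫_{(0,kf]} e^{2hk}k^{2θ}‖f‖²`. [folklore] -/
theorem boxFrequency_apriori {w' lam θ h kf : ℝ} {S : ℂ →L[ℝ] ℂ} {m : ℝ → ℝ} {f Z : ℝ → ℂ}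
    (hw : 0 < w') (hS : ∀ z : ℂ, (starRingEnd ℂ z * S z).re ≤ lam * ‖z‖ ^ 2) (hθ : 1 / 2 + lam / w' < θ) (hh : 0 ≤ h)
    (hkf : 0 < kf)
    (hZ : ∀ k ∈ Set.Ioc 0 kf, HasDerivAt Z ((w' * k)⁻¹ • (f k - (w' • Z k + ((m k : ℂ) * Complex.I) * Z k + S (Z k)))) k)
    (hZkf : Z kf = 0)
    (hIZ : MeasureTheory.IntegrableOn (fun k => Real.exp (2 * h * k) * k ^ (2 * θ) * ‖Z k‖ ^ 2) (Set.Ioc 0 kf))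
    (hIf : MeasureTheory.IntegrableOn (fun k => Real.exp (2 * h * k) * k ^ (2 * θ) * ‖f k‖ ^ 2) (Set.Ioc 0 kf)) :
    ∫ k in Set.Ioc 0 kf, Real.exp (2 * h * k) * k ^ (2 * θ) * ‖Z k‖ ^ 2 ≤
      ((w' * (θ - 1 / 2) - lam)⁻¹) ^ 2 * ∫ k in Set.Ioc 0 kf, Real.exp (2 * h * k) * k ^ (2 * θ) * ‖f k‖ ^ 2 := by
  set A : ℝ := θ - 1 / 2 - lam / w' with hAdef
  have hA : 0 < A := by
    have h1 : lam / w' < θ - 1 / 2 := by linarith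
    rw [hAdef]; linarith
  set E : ℝ → ℝ := fun k => Real.exp (2 * h * k) * k ^ (2 * θ) * ‖Z k‖ ^ 2 with hE
  set Wf : ℝ → ℝ := fun k => Real.exp (2 * h * k) * k ^ (2 * θ) * ‖f k‖ ^ 2 with hWf
  set If : ℝ := ∫ k in Set.Ioc 0 kf, Wf k with hIfdef
  have hWf_nn : ∀ k, 0 < k → 0 ≤ Wf k := fun k hk => by
    have hq : 0 < k ^ (2 * θ) := Real.rpow_pos_of_pos hk _
    show 0 ≤ Real.exp (2 * h * k) * k ^ (2 * θ) * ‖f k‖ ^ 2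
    positivity
  have hE_nn : ∀ k, 0 < k → 0 ≤ E k := fun k hk => by
    have hq : 0 < k ^ (2 * θ) := Real.rpow_pos_of_pos hk _
    show 0 ≤ Real.exp (2 * h * k) * k ^ (2 * θ) * ‖Z k‖ ^ 2
    positivity
  have hIf_nn : 0 ≤ If := MeasureTheory.setIntegral_nonneg measurableSet_Ioc fun k hk => hWf_nn k hk.1
  -- the constant
  have hC : ((w' * (θ - 1 / 2) - lam)⁻¹) ^ 2 = (w' ^ 2 * A)⁻¹ / A := by
    have hwA : w' * (θ - 1 / 2) - lam = w' * A := by rw [hAdef]; field_simp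
    rw [hwA]; field_simp
  -- `G = k·E` and its derivative on `(0, kf]`
  set G : ℝ → ℝ := fun k => k * E k with hG
  set G' : ℝ → ℝ := fun k => E k + k * (Real.exp (2 * h * k) * (2 * h * k ^ (2 * θ) * ‖Z k‖ ^ 2
      + 2 * θ * k ^ (2 * θ - 1) * ‖Z k‖ ^ 2
      + k ^ (2 * θ) * (2 * ⟪Z k, (w' * k)⁻¹ • (f k - (w' • Z k + ((m k : ℂ) * Complex.I) * Z k + S (Z k)))⟫_ℝ))) with hG'
  have hGd : ∀ k ∈ Set.Ioc 0 kf, HasDerivAt G (G' k) k := by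
    intro k hk
    have h1 := (hasDerivAt_id' k).mul (weightedEnergy_hasDerivAt (h := h) (θ := θ) hk.1 (hZ k hk))
    refine h1.congr_deriv ?_
    simp only [hG', hE, one_mul]
  have hpt : ∀ k ∈ Set.Ioc 0 kf, A * E k - (w' ^ 2 * A)⁻¹ * Wf k ≤ G' k := fun k hk =>
    kEnergy_deriv_ge (mk := m k) (fk := f k) (Zk := Z k) hw hk.1 hh hA hS rfl
  -- Step 2: the bound on every `[ε, kf]`, `0 < ε < kf`
  have hstep : ∀ ε, 0 < ε → ε ≤ kf → ∫ k in Set.Ioc ε kf, E k ≤ (w' ^ 2 * A)⁻¹ / A * If := by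
    intro ε hε hεkf
    have hsub : Set.Icc ε kf ⊆ Set.Ioc 0 kf := fun x hx => ⟨hε.trans_le hx.1, hx.2⟩
    have hIZ' : MeasureTheory.IntegrableOn E (Set.Icc ε kf) := hIZ.mono_set hsub
    have hIf' : MeasureTheory.IntegrableOn Wf (Set.Icc ε kf) := hIf.mono_set hsub
    have hφint : MeasureTheory.IntegrableOn (fun k => A * E k - (w' ^ 2 * A)⁻¹ * Wf k) (Set.Icc ε kf) :=
      (hIZ'.const_mul A).sub (hIf'.const_mul _)
    have hcont : ContinuousOn G (Set.Icc ε kf) := fun x hx => (hGd x (hsub hx)).continuousAt.continuousWithinAt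
    have hFTC := intervalIntegral.integral_le_sub_of_hasDeriv_right_of_le hεkf hcont
      (fun x hx => (hGd x (hsub ⟨hx.1.le, hx.2.le⟩)).hasDerivWithinAt) hφint
      (fun x hx => hpt x (hsub ⟨hx.1.le, hx.2.le⟩))
    -- right-hand side: `G kf − G ε = −ε·E ε ≤ 0`
    have hGkf : G kf = 0 := by simp [hG, hE, hZkf]
    have hrhs : G kf - G ε ≤ 0 := by
      rw [hGkf, zero_sub, neg_nonpos]
      exact mul_nonneg hε.le (hE_nn ε hε)
    -- left-hand side: split the interval integral
    have hIoc_sub : Set.Ioc ε kf ⊆ Set.Icc ε kf := Set.Ioc_subset_Icc_self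
    have hIZi : IntervalIntegrable E MeasureTheory.volume ε kf :=
      (intervalIntegrable_iff_integrableOn_Ioc_of_le hεkf).2 (hIZ'.mono_set hIoc_sub)
    have hIfi : IntervalIntegrable Wf MeasureTheory.volume ε kf :=
      (intervalIntegrable_iff_integrableOn_Ioc_of_le hεkf).2 (hIf'.mono_set hIoc_sub)
    have hsplit : ∫ k in ε..kf, (A * E k - (w' ^ 2 * A)⁻¹ * Wf k) =
        A * (∫ k in ε..kf, E k) - (w' ^ 2 * A)⁻¹ * (∫ k in ε..kf, Wf k) := by
      rw [intervalIntegral.integral_sub (hIZi.const_mul A) (hIfi.const_mul _), intervalIntegral.integral_const_mul,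
        intervalIntegral.integral_const_mul]
    have hineq : A * (∫ k in ε..kf, E k) ≤ (w' ^ 2 * A)⁻¹ * (∫ k in ε..kf, Wf k) := by linarith [hFTC, hrhs, hsplit]
    rw [intervalIntegral.integral_of_le hεkf, intervalIntegral.integral_of_le hεkf] at hineq
    -- `∫_{(ε,kf]} Wf ≤ If`
    have hWle : ∫ k in Set.Ioc ε kf, Wf k ≤ If :=
      MeasureTheory.setIntegral_mono_set hIf
        (MeasureTheory.ae_restrict_of_forall_mem measurableSet_Ioc fun k hk => hWf_nn k hk.1)
        (Set.Ioc_subset_Ioc_left hε.le).eventuallyLE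
    have hc : 0 ≤ (w' ^ 2 * A)⁻¹ := by positivity
    have h3 : A * (∫ k in Set.Ioc ε kf, E k) ≤ (w' ^ 2 * A)⁻¹ * If := hineq.trans (mul_le_mul_of_nonneg_left hWle hc)
    rw [div_mul_eq_mul_div, le_div_iff₀ hA]
    linarith
  -- Step 3: `ε ↓ 0` along `ε_n = kf/(n+2)` by monotone convergence of set integrals
  set sN : ℕ → Set ℝ := fun n => Set.Ioc (kf / ((n : ℝ) + 2)) kf with hsN
  have hmono : Monotone sN := by
    intro i j hij
    refine Set.Ioc_subset_Ioc_left ?_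
    exact div_le_div_of_nonneg_left hkf.le (by positivity) (by simpa using hij)
  have hU : (⋃ n, sN n) = Set.Ioc 0 kf := by
    ext x
    simp only [Set.mem_iUnion, hsN, Set.mem_Ioc]
    constructor
    · rintro ⟨n, h1, h2⟩
      exact ⟨(div_pos hkf (by positivity)).trans h1, h2⟩
    · rintro ⟨hx0, hxk⟩
      obtain ⟨n, hn⟩ := exists_nat_gt (kf / x)
      refine ⟨n, ?_, hxk⟩
      have hn2 : (0 : ℝ) < (n : ℝ) + 2 := by positivity
      rw [div_lt_iff₀ hn2]
      have h1 : kf < (n : ℝ) * x := by rwa [div_lt_iff₀ hx0] at hn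
      nlinarith
  have hlim := MeasureTheory.tendsto_setIntegral_of_monotone (μ := MeasureTheory.volume) (f := E)
    (fun n => (measurableSet_Ioc : MeasurableSet (sN n))) hmono (by rw [hU]; exact hIZ)
  rw [hU] at hlim
  have hbound : ∀ n : ℕ, ∫ k in sN n, E k ≤ (w' ^ 2 * A)⁻¹ / A * If := fun n =>
    hstep (kf / ((n : ℝ) + 2)) (div_pos hkf (by positivity))
      (div_le_self hkf.le (by have : (0 : ℝ) ≤ n := Nat.cast_nonneg n; linarith))
  have hfinal : ∫ k in Set.Ioc 0 kf, E k ≤ (w' ^ 2 * A)⁻¹ / A * If := le_of_tendsto' hlim hbound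
  rw [hC]
  exact hfinal

end Summit.NavierStokesRegularity.NavierStokesRegularity.Theorems.BoxFrequencyEnergy

end
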